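import Mathlib.Analysis.Calculus.ImplicitContDiff
import Mathlib.Analysis.Calculus.Deriv.Basic
import Mathlib.Topology.MetricSpace.Pseudo.Lemmas
import HarnessLib

/-!
# The crossing (transit / return) time of a family of curves through a level set is `Cⁿ` in the
# parameter: the implicit function theorem for one scalar equation with a Banach-space parameter

Analysis/Calculus support file (theorems only; no definitions, no named facts).

Let `X` be a real Banach space and `g : X → ℝ → ℝ` a scalar function of a parameter `x ∈ X` and a
time `T ∈ ℝ`, jointly of class `Cⁿ` (`1 ≤ n`, `n ≠ ∞`, `n = ω` allowed) near `(x₀, T₀)`, with NON-ZERO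
TIME DERIVATIVE `∂_T g(x₀, ·)(T₀) ≠ 0` ("transversal crossing").  Then on a ball around `x₀` there is a
`Cⁿ` function `R` (the crossing time) with `R x₀ = T₀`, `g x (R x) = g x₀ T₀`, taking values in a
window `(T₀ − η, T₀ + η)`, and `R x` is the ONLY solution `T` of `g x T = g x₀ T₀` in that window
(`exists_contDiffOn_crossingTime`).  Typical use (dynamical systems in Banach spaces): `g x T = h (Φ_T x)`
for a semiflow `Φ` jointly `C¹` in `(T, x)` at positive times and a `C¹` "section functional" `h`;
then `R` is the Poincaré return / transit time to the section `{h = c}` near a transversal crossing of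
the reference orbit, `C¹` in the initial state (Hale–Lin 1986 §8; Henry 1981 Ch. 8; any ODE text for
the finite-dimensional case).  This is Mathlib's `ContDiffAt.implicitFunction` (implicit function of a
`Cⁿ` equation `f : E₁ × E₂ → F` is `Cⁿ`, 2025/26) specialised to `E₂ = F = ℝ`, where invertibility of
the partial derivative is the non-vanishing of a number, packaged with explicit balls/windows.

* `isInvertible_of_apply_one_ne_zero` — a continuous linear map `ℝ →L[ℝ] ℝ` with `A 1 ≠ 0` is
  invertible;
* `deriv_eq_fderiv_comp_inr` — `∂_T g(x₀, ·)(T₀) = (D(uncurry g)(x₀, T₀) ∘ inr) 1`;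
* `exists_contDiffOn_crossingTime` — the theorem.

## Mathlib / tree search

Mathlib (this pin): `ContDiffAt.implicitFunction`, `….implicitFunction_apply_self`,
`….eventually_apply_implicitFunction`, `….eventually_apply_eq_iff_implicitFunction`,
`….contDiffAt_implicitFunction` (`Analysis/Calculus/ImplicitContDiff`), `ContDiffAt.eventually`,
`Metric.eventually_nhds_iff_ball`, `ball_prod_same`, `Real.ball_eq_Ioo`.  Tree: the scalar two-variable
case `Literature.Analysis.Calculus.exists_implicit_of_partial_ne_zero` (`ScalarImplicitFunction`, `𝕜 × 𝕜`)
and the bordered / Lipschitz / product variants (`BorderedImplicitFunction`, `LipschitzImplicitFunction`,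
`ProductImplicitFunction`); none with a Banach-space parameter and explicit uniqueness window.

## References

Folklore (implicit function theorem; `C¹` return times of Poincaré maps: e.g. Hale–Lin 1986 §8).
-/

noncomputable section

open Set Metric Function Filter
open scoped Topology ContDiff

namespace Literature.Analysis.Calculus

/-- A continuous linear map `A : ℝ →L[ℝ] ℝ` with `A 1 ≠ 0` is invertible (it is multiplication by
`A 1`). [folklore] -/
theorem isInvertible_of_apply_one_ne_zero {A : ℝ →L[ℝ] ℝ} (hA : A 1 ≠ 0) : A.IsInvertible := by
  have hAx : ∀ x : ℝ, A x = x * A 1 := fun x => by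
    have := A.map_smul x 1
    simpa [smul_eq_mul] using this
  set B : ℝ →L[ℝ] ℝ := (A 1)⁻¹ • ContinuousLinearMap.id ℝ ℝ with hB
  have hBx : ∀ x : ℝ, B x = (A 1)⁻¹ * x := fun x => rfl
  have h₁ : Function.LeftInverse B A := fun x => by
    rw [hBx, hAx x]; field_simp
  have h₂ : Function.RightInverse B A := fun x => by
    rw [hAx, hBx]; field_simp
  exact ⟨ContinuousLinearEquiv.equivOfInverse A B h₁ h₂, rfl⟩

variable {X : Type*} [NormedAddCommGroup X] [NormedSpace ℝ X]

/-- The time derivative of `g x₀` at `T₀` is the Fréchet derivative of `uncurry g` at `(x₀, T₀)`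
applied to `(0, 1)`, for `uncurry g` differentiable there. [folklore] -/
theorem deriv_eq_fderiv_comp_inr {g : X → ℝ → ℝ} {x₀ : X} {T₀ : ℝ}
    (hg : DifferentiableAt ℝ (uncurry g) (x₀, T₀)) :
    deriv (g x₀) T₀ = (fderiv ℝ (uncurry g) (x₀, T₀) ∘L ContinuousLinearMap.inr ℝ X ℝ) 1 := by
  have h1 : HasFDerivAt (uncurry g) (fderiv ℝ (uncurry g) (x₀, T₀)) (x₀, T₀) := hg.hasFDerivAt
  have h2 : HasFDerivAt (fun T : ℝ => (x₀, T)) (ContinuousLinearMap.inr ℝ X ℝ) T₀ :=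
    hasFDerivAt_prodMk_right x₀ T₀
  have h3 : HasFDerivAt (uncurry g ∘ fun T : ℝ => (x₀, T))
      (fderiv ℝ (uncurry g) (x₀, T₀) ∘L ContinuousLinearMap.inr ℝ X ℝ) T₀ := h1.comp T₀ h2
  have h4 : HasDerivAt (g x₀) ((fderiv ℝ (uncurry g) (x₀, T₀) ∘L ContinuousLinearMap.inr ℝ X ℝ) 1) T₀ := by
    have := h3.hasDerivAt
    simpa [Function.comp_def] using this
  exact h4.deriv

variable [CompleteSpace X]

/-- **Crossing time, `Cⁿ` in a Banach-space parameter, with a uniqueness window.**  Let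
`g : X → ℝ → ℝ` have `uncurry g` of class `Cⁿ` at `(x₀, T₀)` (`n ≠ 0`, `n ≠ ∞`; `n = ω` allowed) and
`deriv (g x₀) T₀ ≠ 0`.  Then there are `ε, η > 0` and `R : X → ℝ`, `Cⁿ` on `ball x₀ ε`, with `R x₀ = T₀`,
`R x ∈ (T₀ − η, T₀ + η)` and `g x (R x) = g x₀ T₀` for `x ∈ ball x₀ ε`, and such that `R x` is the only
`T ∈ (T₀ − η, T₀ + η)` with `g x T = g x₀ T₀`. [folklore] -/
theorem exists_contDiffOn_crossingTime {n : WithTop ℕ∞} (hn : n ≠ 0) (hn' : n ≠ ∞)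
    {g : X → ℝ → ℝ} {x₀ : X} {T₀ : ℝ} (hg : ContDiffAt ℝ n (uncurry g) (x₀, T₀))
    (hspeed : deriv (g x₀) T₀ ≠ 0) :
    ∃ ε : ℝ, 0 < ε ∧ ∃ η : ℝ, 0 < η ∧ ∃ R : X → ℝ, ContDiffOn ℝ n R (ball x₀ ε) ∧ R x₀ = T₀ ∧
      (∀ x ∈ ball x₀ ε, R x ∈ Ioo (T₀ - η) (T₀ + η) ∧ g x (R x) = g x₀ T₀) ∧
      ∀ x ∈ ball x₀ ε, ∀ T ∈ Ioo (T₀ - η) (T₀ + η), g x T = g x₀ T₀ → T = R x := by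
  -- invertibility of the partial derivative in `T`
  have hinv : (fderiv ℝ (uncurry g) (x₀, T₀) ∘L ContinuousLinearMap.inr ℝ X ℝ).IsInvertible := by
    apply isInvertible_of_apply_one_ne_zero
    rw [← deriv_eq_fderiv_comp_inr (hg.differentiableAt hn)]
    exact hspeed
  -- Mathlib's implicit function
  set R : X → ℝ := hg.implicitFunction hn hinv with hRdef
  have hR0 : R x₀ = T₀ := hg.implicitFunction_apply_self hn hinv
  have hev1 : ∀ᶠ x in 𝓝 x₀, uncurry g (x, R x) = uncurry g (x₀, T₀) :=
    hg.eventually_apply_implicitFunction hn hinv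
  have hev2 : ∀ᶠ v in 𝓝 (x₀, T₀), uncurry g v = uncurry g (x₀, T₀) ↔ R v.1 = v.2 :=
    hg.eventually_apply_eq_iff_implicitFunction hn hinv
  have hcd : ContDiffAt ℝ n R x₀ := hg.contDiffAt_implicitFunction hn hinv
  have hev3 : ∀ᶠ x in 𝓝 x₀, ContDiffAt ℝ n R x := hcd.eventually hn'
  -- the uniqueness window
  obtain ⟨δ, hδ, hδsub⟩ := Metric.eventually_nhds_iff_ball.1 hev2
  have hev4 : ∀ᶠ x in 𝓝 x₀, R x ∈ Ioo (T₀ - δ) (T₀ + δ) := by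
    have hcont : ContinuousAt R x₀ := hcd.continuousAt
    have : Ioo (T₀ - δ) (T₀ + δ) ∈ 𝓝 (R x₀) := by
      rw [hR0]; exact Ioo_mem_nhds (by linarith) (by linarith)
    exact hcont this
  have hev5 : ∀ᶠ x in 𝓝 x₀, x ∈ ball x₀ δ := ball_mem_nhds x₀ hδ
  obtain ⟨ε, hε, hεsub⟩ :=
    Metric.eventually_nhds_iff_ball.1 ((hev1.and hev3).and (hev4.and hev5))
  refine ⟨ε, hε, δ, hδ, R, fun x hx => ((hεsub x hx).1.2).contDiffWithinAt, hR0, fun x hx => ?_,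
    fun x hx T hT hgT => ?_⟩
  · exact ⟨(hεsub x hx).2.1, (hεsub x hx).1.1⟩
  · have hxδ : x ∈ ball x₀ δ := (hεsub x hx).2.2
    have hmem : (x, T) ∈ ball (x₀, T₀) δ := by
      rw [← ball_prod_same (x := x₀) (y := T₀) (r := δ)]
      exact ⟨hxδ, by rw [Real.ball_eq_Ioo]; exact hT⟩
    have h := (hδsub (x, T) hmem).1 hgT
    exact h.symm

end Literature.Analysis.Calculus

end
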